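import Mathlib.Algebra.MvPolynomial.Basic
import Mathlib.RingTheory.MvPolynomial.Basic
import Mathlib.Data.NNReal.Basic
import Literature.Computability.AlgebraicComplexity.ArithCircuit

/-!
# Route DivisionGap — crux `TriangularDimersDivisionEasy` (stmt-ValiantsHypothesis-5067): shared vocabulary of
the line `diagonal-spider-shuffling` (positive city shuffling)

Definitions, plus one normalisation lemma `pmSubst_X_one` (no statement of the line is asserted here).  They are the objects the line posits, factored out of the
checked skeleton `Cruxes/TriangularDimersDivisionEasy/Lines/diagonal_spider_shuffling.lean` so that the
registered stubs — each landed as its own `--supports stmt-ValiantsHypothesis-5067` file under `Theorems/` —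
and the final crux proof all speak about the SAME constants:

* `ihaf W` — the Hafnian-type matching sum of a weight matrix in the crux's own encoding (sum over
  fixed-point-free involutions `f` of `Π_v W v (f v)`; the crux's `D_n` is `ihaf` of the 0/`X`-weighted
  triangular adjacency);
* `gsig X S` — the boundary signature of a gadget on attachments `A` and private vertices `C`;
* `glue Wuu Wua Wau X` — a gadget glued into an ambient graph through its attachments only;
* `AdjR` — the crux's six-disjunct triangular adjacency on `Fin n × Fin n` (verbatim);
* `pm E` — the generic matching polynomial of a finite graph on `Fin k` (doubled oriented edge variables);
* `pmSubst E N D` — `pm E` reweighted by `N i / D i` with denominators cleared edge by edge;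
* `IsSmall B p` — structural smallness of a round item (non-zero, `≤ B` monomials of degree `≤ B`);
* `IsPositiveRound B M E' E` — one positive local round `G' → G` (the round identity
  `pm E' * Π Ld = Π Ln * pmSubst E N D` with small items);
* `Cofinal B sz E` — the even rhombi embed edge-to-edge into the family with perfectly matchable complement.

Sources: Propp 2003 (generalized domino shuffling, §2 urban renewal) for the shape of a round; Hrubeš–Yehudayoff
2021 §6 for the normal form `f · h = g` these feed into. [cite: Propp2003, §2]
-/

-- `Summit.ValiantsHypothesis.ValiantsHypothesis.…` is the tree's mandated single-conjunct layout (Sub = Summit),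
-- so the duplicated namespace component is intended.
set_option linter.dupNamespace false

namespace Summit.ValiantsHypothesis.ValiantsHypothesis.Theorems.TriangularDimersDivisionEasy.Shuffling

open scoped BigOperators NNReal
open Finset MvPolynomial Literature.Computability.AlgebraicComplexity

noncomputable section

section MatchingSums

variable {R : Type} [CommSemiring R]

/-- Hafnian-type matching sum of a weight matrix `W` on a finite vertex type, in the crux's encoding:
sum over fixed-point-free involutions `f` of `Π_v W v (f v)` (each matched pair `{v, w}` contributes
`W v w * W w v`; put weight `0` on non-edges). [folklore] -/
def ihaf {V : Type} [Fintype V] [DecidableEq V] (W : V → V → R) : R :=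
  ∑ f ∈ (univ : Finset (V → V)).filter (fun f => ∀ v, f (f v) = v ∧ f v ≠ v), ∏ v, W v (f v)

/-- Boundary SIGNATURE of a gadget `X` on attachment vertices `A` and private vertices `C`: for `S ⊆ A`,
the matching sum of `X` restricted to the vertex set `S ⊕ C` (the attachments in `S` are matched INSIDE the
gadget, those outside `S` are absent, every private vertex is matched) (Propp 2003 §2; Kuo 2004 §2).
[cite: Propp2003, §2] -/
def gsig {A C : Type} [Fintype A] [DecidableEq A] [Fintype C] [DecidableEq C]
    (X : A ⊕ C → A ⊕ C → R) (S : Finset A) : R :=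
  ihaf (V := {v : A ⊕ C // ∀ a : A, v = Sum.inl a → a ∈ S}) (fun v w => X v.1 w.1)

/-- Gluing a gadget `X` (on `A ⊕ C`) into an ambient graph (other vertices `U`) THROUGH THE ATTACHMENTS ONLY:
ambient weights `Wuu` on `U × U`, `Wua`/`Wau` on `U × A` / `A × U`; no `U–C` edges; all `A–A` edges belong to
the gadget. [cite: Propp2003, §2] -/
def glue {U A C : Type} (Wuu : U → U → R) (Wua : U → A → R) (Wau : A → U → R)
    (X : A ⊕ C → A ⊕ C → R) : U ⊕ (A ⊕ C) → U ⊕ (A ⊕ C) → R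
  | Sum.inl u, Sum.inl u' => Wuu u u'
  | Sum.inl u, Sum.inr (Sum.inl a) => Wua u a
  | Sum.inr (Sum.inl a), Sum.inl u => Wau a u
  | Sum.inl _, Sum.inr (Sum.inr _) => 0
  | Sum.inr (Sum.inr _), Sum.inl _ => 0
  | Sum.inr p, Sum.inr q => X p q

end MatchingSums

/-- Adjacency of the triangular lattice on the rhombus `R_n` — verbatim the crux's six disjuncts
(edges `(i,j)–(i+1,j)`, `(i,j)–(i,j+1)`, `(i,j)–(i+1,j-1)`, both orientations)
(Valiant 1980 §3's lattice; the crux `DivisionGap.TriangularDimersDivisionEasy`). [folklore] -/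
def AdjR {n : ℕ} (v w : Fin n × Fin n) : Prop :=
  ((v.1 : ℕ) + 1 = w.1 ∧ (v.2 : ℕ) = w.2) ∨ ((w.1 : ℕ) + 1 = v.1 ∧ (v.2 : ℕ) = w.2) ∨
  ((v.1 : ℕ) = w.1 ∧ (v.2 : ℕ) + 1 = w.2) ∨ ((v.1 : ℕ) = w.1 ∧ (w.2 : ℕ) + 1 = v.2) ∨
  ((v.1 : ℕ) + 1 = w.1 ∧ (w.2 : ℕ) + 1 = v.2) ∨ ((w.1 : ℕ) + 1 = v.1 ∧ (v.2 : ℕ) + 1 = w.2)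

/-- `AdjR` is decidable (a disjunction of equalities of naturals). [folklore] -/
instance instDecidableAdjR {n : ℕ} (v w : Fin n × Fin n) : Decidable (AdjR v w) := by
  unfold AdjR; infer_instance

/-- GENERIC matching polynomial of the finite graph `E` on `Fin k` in the crux's encoding: sum over
fixed-point-free involutions along `E` of `Π_v X (v, f v)` (doubled oriented edge variables `X (v, w)`). [folklore] -/
def pm {k : ℕ} (E : Fin k → Fin k → Bool) : MvPolynomial (Fin k × Fin k) ℝ≥0 :=
  ∑ f ∈ (univ : Finset (Fin k → Fin k)).filter (fun f => ∀ v, f (f v) = v ∧ f v ≠ v ∧ E v (f v) = true),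
    ∏ v : Fin k, X (v, f v)

/-- The matching polynomial of `E` with the oriented variable `i = (v, w)` REWEIGHTED to `N i / D i`,
denominators cleared edge by edge: `Σ_f (Π_v N (v, f v)) · Π_{i ∈ E unused by f} D i`
(`= M(E)(N/D) · Π_{i ∈ E} D i`, a polynomial because `M(E)` is multilinear in the oriented variables)
(Propp 2003 §2: the shape of the renewed weights `w/Δ`). [cite: Propp2003, §2] -/
def pmSubst {k : ℕ} (E : Fin k → Fin k → Bool) {τ : Type} (N D : Fin k × Fin k → MvPolynomial τ ℝ≥0) :
    MvPolynomial τ ℝ≥0 :=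
  ∑ f ∈ (univ : Finset (Fin k → Fin k)).filter (fun f => ∀ v, f (f v) = v ∧ f v ≠ v ∧ E v (f v) = true),
    (∏ v : Fin k, N (v, f v)) *
      ∏ i ∈ (univ : Finset (Fin k × Fin k)).filter (fun i => E i.1 i.2 = true ∧ f i.1 ≠ i.2), D i

/-- STRUCTURAL SMALLNESS of one item of a round: a NON-ZERO polynomial with at most `B` monomials, each of
total degree `≤ B` (so it depends on `≤ B²` variables, has monotone complexity `O(B²)`, and has an explicit
small bihomogenisation `p(n/d) = Pn(n,d)/Pd(n,d)`). [folklore] -/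
def IsSmall {τ : Type} (B : ℕ) (p : MvPolynomial τ ℝ≥0) : Prop :=
  p ≠ 0 ∧ p.totalDegree ≤ B ∧ p.support.card ≤ B

/-- ONE POSITIVE LOCAL ROUND from the graph `E'` on `Fin k'` to the graph `E` on `Fin k` with locality/size
constant `B` and at most `M` transfer factors: a subtraction-free reweighting `i ↦ N i / D i` of the oriented
variables of `E` by small polynomials in the variables of `E'`, and small transfer factors `Ln`, `Ld` (city
factors, forced-edge weights, clearing denominators), at most `M` of them, with the ROUND IDENTITY
`pm E' * Π Ld = Π Ln * pmSubst E N D` in `ℝ≥0[x']` — i.e. `M(E')(x') = (Π Ln / Π Ld) · Π_{i∈E} (D i)⁻¹ · M(E)(N/D)`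
as subtraction-free rational functions (Propp 2003 §2: the Aztec round has `N/D = w/Δ`, `Ln =` the cell
factors `Δ`). [cite: Propp2003, §2] -/
def IsPositiveRound (B M : ℕ) {k' k : ℕ} (E' : Fin k' → Fin k' → Bool) (E : Fin k → Fin k → Bool) : Prop :=
  ∃ (N D : Fin k × Fin k → MvPolynomial (Fin k' × Fin k') ℝ≥0)
    (Ln Ld : List (MvPolynomial (Fin k' × Fin k') ℝ≥0)),
    (∀ i, IsSmall B (N i) ∧ IsSmall B (D i)) ∧
    (∀ p ∈ Ln ++ Ld, IsSmall B p) ∧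
    Ln.length + Ld.length ≤ M ∧
    pm E' * Ld.prod = Ln.prod * pmSubst E N D

/-- COFINALITY of a graph family `(E m on Fin (sz m))_m` for the rhombi: every EVEN rhombus `R_n` embeds into
some member of polynomially bounded index, edges to edges, onto a vertex set whose complement has a perfect
matching inside the member. [folklore] -/
def Cofinal (B : ℕ) (sz : ℕ → ℕ) (E : ∀ m, Fin (sz m) → Fin (sz m) → Bool) : Prop :=
  ∀ n : ℕ, Even n → ∃ m : ℕ, m ≤ (n + B) ^ B ∧ ∃ ι : Fin n × Fin n ↪ Fin (sz m),
    (∀ v w : Fin n × Fin n, AdjR v w → E m (ι v) (ι w) = true) ∧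
    ∃ g : Fin (sz m) → Fin (sz m), ∀ u : Fin (sz m), u ∉ Set.range ι →
      g (g u) = u ∧ g u ≠ u ∧ g u ∉ Set.range ι ∧ E m u (g u) = true

/-- Sanity/normalisation of the reweighting: with numerators the variables themselves and all denominators `1`,
`pmSubst` is `pm` (used at the END of the composition of rounds, where the bihomogeneous normal form is
specialised back to plain variables). [folklore] -/
theorem pmSubst_X_one {k : ℕ} (E : Fin k → Fin k → Bool) :
    pmSubst E (fun i => (X i : MvPolynomial (Fin k × Fin k) ℝ≥0)) (fun _ => 1) = pm E := by
  unfold pmSubst pm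
  refine Finset.sum_congr rfl fun f _ => ?_
  rw [Finset.prod_const_one, mul_one]

end

end Summit.ValiantsHypothesis.ValiantsHypothesis.Theorems.TriangularDimersDivisionEasy.Shuffling
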